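import Literature.NumberTheory.GaloisRepresentations.CyclicLayerSurjective
import Literature.NumberTheory.GaloisRepresentations.ShapiroInjective
import HarnessLib

/-!
# Kernels of restriction maps on `H²` along a tower of closed subgroups (Serre, *Corps locaux* XIII §3)

Bookkeeping for the cohomological proof that the Brauer group `Br(L/K) = ker(H²(Γ_K, K̄ˣ) →
H²(Γ_L, K̄ˣ))` of a finite Galois extension has order `≤ [L:K]` (Serre, *Corps locaux*, XIII §3,
via cyclic layers; Milne, *Class Field Theory*, III Thm. 2.1).  For a profinite group `G`, a
discrete `G`-module `A` and closed subgroups `U ≤ T ≤ S ≤ G`: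

* `resSub ρ h n : Hⁿ(S, A) → Hⁿ(T, A)` for `h : T ≤ S` (Mathlib `ContinuousCohomology.map` along
  the inclusion), its transitivity on classes (`resSub_resSub`, from the tree's pointwise
  `cochainsMap_comp_apply_of`), and the subgroup `resKer ρ h = ker(res)`;
* **multiplicativity**: `|resKer(S → U)| ≤ |resKer(S → T)| · |resKer(T → U)|`
  (`natCard_resKer_le_mul`);
* comparison of `res` to a subgroup `T' ≤ S` of the subtype `↥S` with `res` to its image in `G`
  (`resSub_eq_zero_iff_resH_eq_zero`), so that the cyclic-layer theory (`CyclicLayerCarry`,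
  `CyclicLayerSurjective`, stated on the group `↥S` and `χ.ker ≤ ↥S`) bounds `resKer`:
  **`|resKer(S → T)| ≤ |A^S / N₀|`** for a cyclic layer with `H¹(T, A) = 0` and any subgroup `N₀`
  of norms (`natCard_resKer_le_of_cyclicLayer`);
* **injectivity on `p`-primary classes of the restriction to an open subgroup of index prime to
  `p`** at class level (`resSub_injective_on_pPrimary`, from the tree's cochain-level
  `exists_d_eq_index_smul_of_res_eq_d`, `Cor ∘ Res = index`).

## References

* J.-P. Serre, *Corps locaux* (1968) / *Local Fields* (1979), XIII §3 (`H²(L/K)` has order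
  `≤ [L:K]`: reduction to cyclic layers of prime degree), VII §6. [SerreLocalFields1979]
* J.-P. Serre, *Cohomologie galoisienne* (1997), I §2.4 Prop. 9 (`Cor ∘ Res`). [SerreGaloisCohomology1997]
-/

noncomputable section

open CategoryTheory Limits Function

universe u

namespace Literature.NumberTheory.GaloisRepresentations

open _root_.TopRep _root_.ContRepresentation _root_.ContinuousCohomology

set_option allowUnsafeReducibility true in
attribute [local reducible] CategoryTheory.Functor.mapHomologicalComplex

/-! ### Functoriality on classes along pointwise composites -/

section MapComp

variable {k : Type*} [CommRing k] [TopologicalSpace k]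
variable {G : Type u} [Group G] [TopologicalSpace G] [IsTopologicalGroup G]
variable {H : Type u} [Group H] [TopologicalSpace H] [IsTopologicalGroup H]
variable {K : Type u} [Group K] [TopologicalSpace K] [IsTopologicalGroup K]
variable {X : TopRep.{u} k G} {Y : TopRep.{u} k H} {Z : TopRep.{u} k K}

/-- **`H(χ, h) = H(ψ, g) ∘ H(φ, f)` on classes** for `χ = φ ∘ ψ`, `h = g ∘ f` given pointwise
(the tree's `cochainsMap_comp_apply_of`, on homology classes). [cite: SerreGaloisCohomology1997, I §2.4] -/
theorem map_comp_apply_of (φ : H →ₜ* G) (ψ : K →ₜ* H) (χ : K →ₜ* G)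
    (hχ : ∀ x, χ x = φ (ψ x)) (f : res (φ : H →* G) X ⟶ Y) (g : res (ψ : K →* H) Y ⟶ Z)
    (h : res (χ : K →* G) X ⟶ Z) (hh : ∀ v, h.hom v = g.hom (f.hom v)) (n : ℕ)
    (z : continuousCohomology n X) :
    ContinuousCohomology.map χ h n z =
      ContinuousCohomology.map ψ g n (ContinuousCohomology.map φ f n z) := by
  obtain ⟨x, hx, rfl⟩ := cxClass_surjective (homogeneousCochains X) n (n + 1) (up_nat_next n) z
  have h1 : (homogeneousCochains Y).d n (n + 1) ((cochainsMap φ f).f n x) = 0 := by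
    rw [hom_f_d_apply, hx, map_zero]
  unfold ContinuousCohomology.map
  rw [homologyMap_cxClass (cochainsMap φ f) n (n + 1) (up_nat_next n) x hx _ h1 rfl,
    homologyMap_cxClass (cochainsMap ψ g) n (n + 1) (up_nat_next n) _ h1 _
      (by rw [hom_f_d_apply, h1, map_zero]) rfl,
    homologyMap_cxClass (cochainsMap χ h) n (n + 1) (up_nat_next n) x hx _
      (by rw [hom_f_d_apply, hx, map_zero]) rfl]
  exact cxClass_congr (cochainsMap_comp_apply_of φ ψ χ hχ f g h hh n x)

end MapComp

/-! ### Restriction between closed subgroups -/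

section ResSub

variable {G : Type u} [Group G] [TopologicalSpace G] [IsTopologicalGroup G]
variable {A : Type u} [AddCommGroup A] [TopologicalSpace A] [DiscreteTopology A]
variable (ρ : ContinuousRep G ℤ A)

/-- The inclusion of subgroups `T ≤ S` as a continuous homomorphism. [folklore] -/
def inclHom {T S : Subgroup G} (h : T ≤ S) : T →ₜ* S :=
  ⟨Subgroup.inclusion h, continuous_inclusion h⟩

omit [IsTopologicalGroup G] in
/-- Unfolding `inclHom`. [folklore] -/
@[simp] theorem inclHom_apply {T S : Subgroup G} (h : T ≤ S) (t : T) :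
    inclHom h t = Subgroup.inclusion h t := rfl

/-- The identity of `A` as a morphism `(A|_S)|_T ⟶ A|_T`. [folklore] -/
def resSubMod {T S : Subgroup G} (h : T ≤ S) :
    TopRep.res ((inclHom h : T →ₜ* S) : T →* S) ((ρ.restrict (subgroupIncl S)).toTopRep) ⟶
      (ρ.restrict (subgroupIncl T)).toTopRep :=
  TopRep.ofHom ⟨ContinuousLinearMap.id ℤ A, fun _ => rfl⟩

omit [IsTopologicalGroup G] in
/-- Unfolding `resSubMod`. [folklore] -/
@[simp] theorem resSubMod_hom_apply {T S : Subgroup G} (h : T ≤ S) (a : A) :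
    (resSubMod ρ h).hom a = a := rfl

/-- **The restriction `res : Hⁿ(S, A) → Hⁿ(T, A)` for closed subgroups `T ≤ S`.**
[cite: SerreGaloisCohomology1997, I §2.4] -/
abbrev resSub {T S : Subgroup G} (h : T ≤ S) (n : ℕ) :
    continuousCohomology n (ρ.restrict (subgroupIncl S)).toTopRep ⟶
      continuousCohomology n (ρ.restrict (subgroupIncl T)).toTopRep :=
  ContinuousCohomology.map (inclHom h) (resSubMod ρ h) n

/-- **Transitivity of restriction**: `res_{T→U} ∘ res_{S→T} = res_{S→U}`. [folklore] -/
theorem resSub_resSub {U T S : Subgroup G} (hUT : U ≤ T) (hTS : T ≤ S) (n : ℕ)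
    (z : continuousCohomology n (ρ.restrict (subgroupIncl S)).toTopRep) :
    resSub ρ hUT n (resSub ρ hTS n z) = resSub ρ (hUT.trans hTS) n z :=
  (map_comp_apply_of (inclHom hTS) (inclHom hUT) (inclHom (hUT.trans hTS)) (fun _ => rfl)
    (resSubMod ρ hTS) (resSubMod ρ hUT) (resSubMod ρ (hUT.trans hTS)) (fun _ => rfl) n z).symm

/-- **The kernel `ker(res : H²(S, A) → H²(T, A))`** (for `A = K̄ˣ`, `S = Γ_K`, `T = Γ_L`: the
relative Brauer group `Br(L/K)`). [cite: SerreLocalFields1979, XIII §3] -/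
def resKer {T S : Subgroup G} (h : T ≤ S) :
    AddSubgroup (continuousCohomology 2 (ρ.restrict (subgroupIncl S)).toTopRep) :=
  (resSub ρ h 2).hom.toLinearMap.toAddMonoidHom.ker

/-- Membership in `resKer`. [folklore] -/
@[simp] theorem mem_resKer {T S : Subgroup G} (h : T ≤ S)
    (z : continuousCohomology 2 (ρ.restrict (subgroupIncl S)).toTopRep) :
    z ∈ resKer ρ h ↔ resSub ρ h 2 z = 0 := Iff.rfl

/-- **Multiplicativity of kernels along `U ≤ T ≤ S`**: if `ker(res_{S→T})` and `ker(res_{T→U})`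
are finite then so is `ker(res_{S→U})`, of order at most the product (the map
`ker(res_{S→U}) → ker(res_{T→U})`, `z ↦ res_{S→T} z`, has kernel `ker(res_{S→T})`).
[cite: SerreLocalFields1979, XIII §3] -/
theorem natCard_resKer_le_mul {U T S : Subgroup G} (hUT : U ≤ T) (hTS : T ≤ S)
    [Finite (resKer ρ hTS)] [Finite (resKer ρ hUT)] :
    Finite (resKer ρ (hUT.trans hTS)) ∧
      Nat.card (resKer ρ (hUT.trans hTS)) ≤ Nat.card (resKer ρ hTS) * Nat.card (resKer ρ hUT) := by
  classical
  -- `res_{S→T}` maps `ker(res_{S→U})` into `ker(res_{T→U})`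
  let r : resKer ρ (hUT.trans hTS) →+ resKer ρ hUT :=
    { toFun := fun z => ⟨resSub ρ hTS 2 z.1, by
        rw [mem_resKer, resSub_resSub]; exact (mem_resKer _ _ _).1 z.2⟩
      map_zero' := Subtype.ext (map_zero _)
      map_add' := fun _ _ => Subtype.ext (map_add _ _ _) }
  -- its kernel embeds in `ker(res_{S→T})`
  have hk : ∀ z : r.ker, (z.1.1 : _) ∈ resKer ρ hTS := fun z => by
    rw [mem_resKer]
    exact congrArg Subtype.val ((AddMonoidHom.mem_ker).1 z.2)
  let i : r.ker → resKer ρ hTS := fun z => ⟨z.1.1, hk z⟩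
  have hi : Injective i := fun a b hab => Subtype.ext (Subtype.ext (congrArg (fun x => x.1) hab))
  haveI : Finite r.ker := Finite.of_injective i hi
  haveI : Finite r.range := inferInstance
  have hcard : Nat.card (resKer ρ (hUT.trans hTS)) = Nat.card r.range * Nat.card r.ker := by
    rw [AddSubgroup.card_eq_card_quotient_mul_card_addSubgroup r.ker,
      Nat.card_congr (QuotientAddGroup.quotientKerEquivRange r).toEquiv]
  have hfin : Finite (resKer ρ (hUT.trans hTS)) := by
    refine Nat.finite_of_card_ne_zero ?_
    rw [hcard]
    exact Nat.mul_ne_zero Nat.card_pos.ne' Nat.card_pos.ne'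
  refine ⟨hfin, ?_⟩
  rw [hcard, mul_comm]
  exact Nat.mul_le_mul (Nat.card_le_card_of_injective i hi)
    (Nat.card_le_card_of_injective _ r.range.subtype_injective)

end ResSub

/-! ### Comparison with restriction to a subgroup of the subtype `↥S` -/

section Compare

variable {G : Type u} [Group G] [TopologicalSpace G] [IsTopologicalGroup G]
variable {A : Type u} [AddCommGroup A] [TopologicalSpace A] [DiscreteTopology A]
variable (ρ : ContinuousRep G ℤ A) {S : Subgroup G} (T' : Subgroup S)

omit [TopologicalSpace G] [IsTopologicalGroup G] in
/-- The image in `G` of a subgroup `T'` of `↥S` lies in `S`. [folklore] -/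
theorem map_subtype_le' : T'.map S.subtype ≤ S := Subgroup.map_subtype_le T'

omit [TopologicalSpace G] [IsTopologicalGroup G] in
/-- An element of the image of `T'` lies in `S`. [folklore] -/
theorem mem_of_mem_map' {x : G} (hx : x ∈ T'.map S.subtype) : x ∈ S := map_subtype_le' T' hx

omit [TopologicalSpace G] [IsTopologicalGroup G] in
/-- An element of the image of `T'`, seen in `S`, lies in `T'`. [folklore] -/
theorem mk_mem_of_mem_map' {x : G} (hx : x ∈ T'.map S.subtype) :
    (⟨x, mem_of_mem_map' T' hx⟩ : S) ∈ T' := by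
  obtain ⟨y, hy, rfl⟩ := hx
  exact hy

/-- The continuous homomorphism `↥T' → ↥(T'.map S.subtype)`, `t ↦ t`. [folklore] -/
def toMapHom : T' →ₜ* (T'.map S.subtype) where
  toFun t := ⟨t.1.1, ⟨t.1, t.2, rfl⟩⟩
  map_one' := rfl
  map_mul' _ _ := rfl
  continuous_toFun := Continuous.subtype_mk (continuous_subtype_val.comp continuous_subtype_val) _

/-- The continuous homomorphism `↥(T'.map S.subtype) → ↥T'`, `x ↦ x`. [folklore] -/
def ofMapHom : (T'.map S.subtype) →ₜ* T' where
  toFun x := ⟨⟨x.1, mem_of_mem_map' T' x.2⟩, mk_mem_of_mem_map' T' x.2⟩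
  map_one' := rfl
  map_mul' _ _ := rfl
  continuous_toFun := Continuous.subtype_mk (Continuous.subtype_mk continuous_subtype_val _) _

omit [IsTopologicalGroup G] in
/-- Unfolding `toMapHom`. [folklore] -/
@[simp] theorem coe_toMapHom_apply (t : T') : ((toMapHom T' t : T'.map S.subtype) : G) = t := rfl

omit [IsTopologicalGroup G] in
/-- Unfolding `ofMapHom`. [folklore] -/
@[simp] theorem coe_ofMapHom_apply (x : T'.map S.subtype) : (((ofMapHom T' x : T') : S) : G) = x := rfl

/-- **`res` to a subgroup `T'` of `↥S` vanishes iff `res` to its image `T ≤ S` in `G` vanishes**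
(the two restrictions differ by the isomorphism `↥T' ≅ ↥T`: `res_{T'} = H(T' → T) ∘ res_T` and
`res_T = H(T → T') ∘ res_{T'}` on classes, `map_comp_apply_of`). [folklore] -/
theorem resSub_eq_zero_iff_resH_eq_zero (n : ℕ)
    (z : continuousCohomology n (ρ.restrict (subgroupIncl S)).toTopRep) :
    resSub ρ (map_subtype_le' T') n z = 0 ↔ resH T' (ρ.restrict (subgroupIncl S)) n z = 0 := by
  let f : TopRep.res ((toMapHom T' : T' →ₜ* T'.map S.subtype) : T' →* T'.map S.subtype)
      ((ρ.restrict (subgroupIncl (T'.map S.subtype))).toTopRep) ⟶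
      ((ρ.restrict (subgroupIncl S)).restrict (subgroupIncl T')).toTopRep :=
    TopRep.ofHom ⟨ContinuousLinearMap.id ℤ A, fun _ => rfl⟩
  let g : TopRep.res ((ofMapHom T' : T'.map S.subtype →ₜ* T') : T'.map S.subtype →* T')
      (((ρ.restrict (subgroupIncl S)).restrict (subgroupIncl T')).toTopRep) ⟶
      (ρ.restrict (subgroupIncl (T'.map S.subtype))).toTopRep :=
    TopRep.ofHom ⟨ContinuousLinearMap.id ℤ A, fun _ => rfl⟩
  have h1 : resH T' (ρ.restrict (subgroupIncl S)) n z =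
      ContinuousCohomology.map (toMapHom T') f n (resSub ρ (map_subtype_le' T') n z) :=
    map_comp_apply_of (inclHom (map_subtype_le' T')) (toMapHom T') (subgroupIncl T')
      (fun _ => rfl) (resSubMod ρ (map_subtype_le' T')) f
      (𝟙 (((ρ.restrict (subgroupIncl S)).restrict (subgroupIncl T')).toTopRep)) (fun _ => rfl) n z
  have h2 : resSub ρ (map_subtype_le' T') n z =
      ContinuousCohomology.map (ofMapHom T') g n (resH T' (ρ.restrict (subgroupIncl S)) n z) :=
    map_comp_apply_of (X := (ρ.restrict (subgroupIncl S)).toTopRep)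
      (Y := ((ρ.restrict (subgroupIncl S)).restrict (subgroupIncl T')).toTopRep)
      (Z := (ρ.restrict (subgroupIncl (T'.map S.subtype))).toTopRep)
      (subgroupIncl T') (ofMapHom T') (inclHom (map_subtype_le' T'))
      (fun _ => rfl) (𝟙 (((ρ.restrict (subgroupIncl S)).restrict (subgroupIncl T')).toTopRep)) g
      (resSubMod ρ (map_subtype_le' T')) (fun _ => rfl) n z
  constructor
  · intro h; rw [h1, h, map_zero]
  · intro h; rw [h2, h, map_zero]

end Compare

/-! ### The cyclic-layer bound -/

section CyclicBound

variable {G : Type u} [Group G] [TopologicalSpace G] [IsTopologicalGroup G] [CompactSpace G]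
  [T2Space G] [TotallyDisconnectedSpace G]
variable {A : Type u} [AddCommGroup A] [TopologicalSpace A] [DiscreteTopology A]
variable (ρ : ContinuousRep G ℤ A) {S : Subgroup G} [hS : IsClosed (S : Set G)]
variable {d : ℕ} [NeZero d] [Fact (1 < d)] (χ : CyclicCharacter S d)

/-- **The cyclic-layer bound**: for a closed subgroup `S` of a profinite group, a cyclic layer
`χ : ↥S → ℤ/d` with kernel `T'` such that `H¹(T', A) = 0`, and any subgroup `N₀ ≤ A^S` killed by
`κ` (e.g. the norms `N_s A^{T'}`, `cyclicClass_cycNorm`) with `A^S/N₀` finite: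
`ker(res : H²(S, A) → H²(T, A))` is finite of order `≤ |A^S / N₀|`, `T` the image of `T'` in `G`
(`ker res = κ(A^S)` by `exists_cyclicClass_eq_of_res_eq_zero` + `map_res_cyclicClass`, and `κ`
factors through `A^S / N₀`).  For `A = K̄ˣ`: `|Br(L/K)| ≤ (Kˣ : N Lˣ)` for cyclic `L/K`.
[cite: SerreLocalFields1979, XIII §3 and VIII §4] -/
theorem natCard_resKer_le_of_cyclicLayer
    (hT : Subsingleton (continuousCohomology 1
      (((ρ.restrict (subgroupIncl S)).restrict (subgroupIncl χ.ker)).toTopRep)))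
    (N₀ : AddSubgroup ((ρ.restrict (subgroupIncl S)).toTopRep.ρ.invariants))
    (hN₀ : ∀ a ∈ N₀, cyclicClass χ (ρ.restrict (subgroupIncl S)) a = 0)
    [Finite (((ρ.restrict (subgroupIncl S)).toTopRep.ρ.invariants) ⧸ N₀)] :
    Finite (resKer ρ (map_subtype_le' χ.ker)) ∧
      Nat.card (resKer ρ (map_subtype_le' χ.ker)) ≤
        Nat.card (((ρ.restrict (subgroupIncl S)).toTopRep.ρ.invariants) ⧸ N₀) := by
  classical
  haveI : CompactSpace S := isCompact_iff_compactSpace.mp hS.isCompact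
  haveI : CompactSpace χ.ker := isCompact_iff_compactSpace.mp χ.isClosed_ker.isCompact
  -- `κ` descends to `A^S / N₀`, onto `ker res`
  let κ := cyclicClass χ (ρ.restrict (subgroupIncl S))
  have hle : N₀ ≤ κ.ker := fun a ha => (AddMonoidHom.mem_ker).2 (hN₀ a ha)
  let κ' := QuotientAddGroup.lift N₀ κ hle
  have hrange : ∀ z : resKer ρ (map_subtype_le' χ.ker), ∃ q, κ' q = z.1 := fun z => by
    have hz := (resSub_eq_zero_iff_resH_eq_zero ρ χ.ker 2 z.1).1 ((mem_resKer _ _ _).1 z.2)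
    obtain ⟨a, ha⟩ := exists_cyclicClass_eq_of_res_eq_zero χ (ρ.restrict (subgroupIncl S)) hT z.1 hz
    exact ⟨QuotientAddGroup.mk a, ha⟩
  choose q hq using hrange
  have hinj : Injective q := fun z₁ z₂ h => Subtype.ext (by rw [← hq z₁, ← hq z₂, h])
  exact ⟨Finite.of_injective q hinj, Nat.card_le_card_of_injective q hinj⟩

end CyclicBound

/-! ### Injectivity of `res` on `p`-primary classes for index prime to `p` -/

section Coprime

variable {G : Type u} [Group G] [TopologicalSpace G] [IsTopologicalGroup G] [CompactSpace G]
  [T2Space G] [TotallyDisconnectedSpace G]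
variable {A : Type u} [AddCommGroup A] [TopologicalSpace A] [DiscreteTopology A]
variable (ρ : ContinuousRep G ℤ A) (S₁ : Subgroup G)

/-- **`(G : S₁) · z = 0` for a class `z ∈ H²(G, A)` whose restriction to the open subgroup `S₁`
vanishes** (`Cor ∘ Res = index`, the tree's `exists_d_eq_index_smul_of_res_eq_d`).
[cite: SerreGaloisCohomology1997, I §2.4 Prop. 9] -/
theorem index_smul_eq_zero_of_resH_eq_zero (hS₁ : IsOpen (S₁ : Set G))
    (z : continuousCohomology 2 ρ.toTopRep) (hz : resH S₁ ρ 2 z = 0) : S₁.index • z = 0 := by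
  obtain ⟨a, ha, rfl⟩ := cxClass_surjective (homogeneousCochains ρ.toTopRep) 2 3 up_nat_next_two z
  have hres : ∃ c : (homogeneousCochains (ρ.restrict (subgroupIncl S₁)).toTopRep).X 1,
      (homogeneousCochains (ρ.restrict (subgroupIncl S₁)).toTopRep).d 1 2 c =
        (cochainsMap (subgroupIncl S₁) (𝟙 ((ρ.restrict (subgroupIncl S₁)).toTopRep))).f 2 a := by
    have h := hz
    unfold resH ContinuousCohomology.map at h
    rw [homologyMap_cxClass _ 2 3 up_nat_next_two a ha _ (by rw [hom_f_d_apply, ha, map_zero]) rfl,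
      cxClass_eq_zero_iff _ 2 3 up_nat_next_two 1 up_nat_prev_two] at h
    exact h
  obtain ⟨e, he⟩ := exists_d_eq_index_smul_of_res_eq_d ρ hS₁ 1 a ha hres
  have h2 : cxClass (homogeneousCochains ρ.toTopRep) 2 3 up_nat_next_two ((S₁.index : ℤ) • a)
      (by rw [map_smul, ha, smul_zero]) = 0 :=
    (cxClass_eq_zero_iff _ 2 3 up_nat_next_two 1 up_nat_prev_two _ _).2 ⟨e, he⟩
  rw [cxClass_smul _ 2 3 up_nat_next_two (S₁.index : ℤ) a ha, Nat.cast_smul_eq_nsmul] at h2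
  exact h2

/-- **Restriction to an open subgroup of index prime to `p` is injective on `p`-primary classes**
of `H²` (Serre I §3.3: "Res est injectif sur les composantes `p`-primaires"; Bezout with
`(G : S₁) · z = 0`). [cite: SerreGaloisCohomology1997, I §3.3 Prop. 14 and Cor. 1] -/
theorem eq_zero_of_resH_eq_zero_of_psmul_eq_zero (hS₁ : IsOpen (S₁ : Set G)) {p r : ℕ}
    (hcop : S₁.index.Coprime p) (z : continuousCohomology 2 ρ.toTopRep) (hz : resH S₁ ρ 2 z = 0)
    (hp : (p ^ r) • z = 0) : z = 0 := by
  have hm := index_smul_eq_zero_of_resH_eq_zero ρ S₁ hS₁ z hz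
  have h := gcd_nsmul_eq_zero.2 ⟨hm, hp⟩
  rwa [(Nat.Coprime.pow_right r hcop).gcd_eq_one, one_nsmul] at h

end Coprime

end Literature.NumberTheory.GaloisRepresentations

end
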